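import Mathlib
import Literature.Analysis.FluidPDE.SelfSimilarEulerOutgoingExclusionTools
import Literature.Analysis.FluidPDE.WholeSpaceIBP
import HarnessLib

/-!
# «JETS MUST TURN», tools — the boundary-free FLUX IDENTITY of a weight along the similarity transport field and its shell form
# (crux `EulerZoomLiouville.PowerGaugeEulerLiouville` = stmt-NavierStokesRegularity-19832, THE ONE STATEMENT `stub_selfSimilarC2Needle`, T2 face;
#  line `needle_faces` stub B `stub_pressureFace` (ns-idea-11 g7) «flux law Q_in ≤ Q_out + 3γ·vol(high ∩ far)»; width seat ns-ezl-w1 g5)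

Route №10 `EulerZoomLiouville` (NavierStokesRegularity).  Let `(U, P)` be a `C²` self-similar Euler profile on `ℝ³` (CIV (3.3), exponent `γ`,
centre `0`), `W = γy + U` its similarity transport field (`div W = 3γ`, CIV (3.22)).  For a `C¹` weight `ω` and a compactly supported `C¹` test
function `τ`, Leray's boundary-free divergence identity `∫ div(ω τ W) = 0` reads

  `3γ ∫ ω τ + ∫ ω Dτ[W] + ∫ τ Dω[W] = 0`            (`flux_identity`).

With `τ = θ_out − θ_in` a difference of Tao cutoffs (`θ_{R,r} = S((R² − |x|²)/(rR))`, `S = Real.smoothTransition`, `Dθ_{R,r}(x)[w] = −k(x)⟪x, w⟫`,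
`k = (2/(rR)) S′ ≥ 0` living on the layer `R(R−r) ≤ |x|² ≤ R²`: `fderiv_taoCutoff_apply`, `fluxDensity_nonneg`,
`fderiv_taoCutoff_apply_eq_zero_of_not_mem_layer`) the quantity

  `F_{R,r}(ω) := ∫ ω(x) · (−Dθ_{R,r}(x)[W x]) dx = ∫ ω k ⟪x, W⟫`

is the (smeared) OUTWARD RADIAL `W`-FLUX OF THE `ω`-SET THROUGH THE SPHERE LAYER, and:

* **`flux_shell_identity`** — `F_out(ω) − F_in(ω) = 3γ ∫ ω (θ_out − θ_in) + ∫ (θ_out − θ_in) Dω[W]` (`θ_in ≤ θ_out` nested, `R₁ ≤ R₂ − r₂`);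
* **`flux_exit_law`** — if `ω` is NON-INCREASING ALONG `W` (`Dω[W] ≤ 0`; the model is `ω = S((ℋ_P − h)/η)`, CIV (3.33) `W·∇ℋ = (2γ−1)|W|² ≤ 0`
  for `γ ≤ ½`): `F_out(ω) − F_in(ω) ≤ 3γ ∫ ω (θ_out − θ_in)` — between two layers the flux grows at most by `3γ ×` the `ω`-mass in between (the flow
  LEAVES the `ω`-set laterally);
* **`abs_flux_le`** — `|F_{R,r}(ω)| ≤ (2M/(rR))·[R² vol(A)/2 + γ²R² vol(A) + ∫_{B̄_R}|U|²]`, `A = layer ∩ {ω ≠ 0}`, `|S′| ≤ M`, for `0 ≤ ω ≤ 1`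
  (pointwise `|⟪x,W⟫| ≤ R²/2 + |W|²/2`, `|W|² ≤ 2γ²R² + 2|U|²`): the outer flux of a far-thin `ω`-set is small.

The assembled TURNING LAW (`F_{R,r}(ω) ≥ −3γ·vol(far ω-set)`) and its Bernoulli-high-set instance are in `…SelfSimilarHighSetFlux`.
Eulerian twin of the Lagrangian volume law `vol(Φ_{−t}A) = e^{−3γt} vol A` of the squeeze files; no divergence theorem on balls is needed
(everything is boundary-free, Leray 1934 §6 (1.11)).

HONEST LABEL: tool (global bookkeeping identity) for the T2 face / stub B; nothing here excludes a needle.  WHAT THIS IS NOT: not NS, not E —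
`--supports` stmt-19832 on the MODEL lattice; 19832 OPEN; NS regularity NOT proved. [folklore; ConstantinIgnatovaVicol2026Putative §3.4.1 (3.22),
§3.4.3 (3.33); Leray1934 §6 (1.11); Tao2011 §8 (58)]
-/

noncomputable section

-- flat `Theorems/<Route><Decl>…` files of one crux share the namespace of the crux (tree convention)
set_option linter.dupNamespace false

open MeasureTheory Set Filter Topology Metric Function InnerProductSpace
open scoped RealInnerProductSpace NNReal ENNReal

namespace Summit.NavierStokesRegularity.NavierStokesRegularity.Theorems.PowerGaugeEulerLiouville.HighSetFlux

open Literature.Analysis Literature.Analysis.FluidPDE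

/-! ### The Tao cutoff layer: flux density, sign, support -/

/-- The derivative of the Tao cutoff `θ_{R,r}(x) = S((R² − |x|²)/(rR))` along a vector:
`Dθ_{R,r}(x)[w] = −((2/(rR)) S′(s)) ⟪x, w⟫`, `s = (R² − |x|²)/(rR)`. [cite: Tao2011, §8, proof of Lemma 8.1, (58)] -/
theorem fderiv_taoCutoff_apply (R r : ℝ) (x w : EuclideanSpace ℝ (Fin 3)) :
    fderiv ℝ (taoCutoff R r) x w =
      -((2 / (r * R)) * deriv Real.smoothTransition ((R ^ 2 - ‖x‖ ^ 2) / (r * R))) * ⟪x, w⟫ := by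
  rw [(hasFDerivAt_taoCutoff R r x).fderiv]
  simp only [_root_.smul_apply, innerSL_apply_apply, smul_eq_mul]
  ring

/-- The flux density `k = (2/(rR)) S′(s)` of the layer is non-negative for `0 < r`, `0 < R` (`S` is monotone). [folklore] -/
theorem fluxDensity_nonneg {R r : ℝ} (hr : 0 < r) (hR : 0 < R) (x : EuclideanSpace ℝ (Fin 3)) :
    0 ≤ (2 / (r * R)) * deriv Real.smoothTransition ((R ^ 2 - ‖x‖ ^ 2) / (r * R)) :=
  mul_nonneg (by positivity) (Real.smoothTransition.monotone.deriv_nonneg)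

/-- Off the closed ball `|x| ≤ R` the argument `s` is negative and `S′(s) = 0` (`S = 0` near `s`). [folklore] -/
theorem deriv_smoothTransition_arg_eq_zero_of_lt_norm {R r : ℝ} (hr : 0 < r) (hR : 0 < R)
    {x : EuclideanSpace ℝ (Fin 3)} (hx : R < ‖x‖) :
    deriv Real.smoothTransition ((R ^ 2 - ‖x‖ ^ 2) / (r * R)) = 0 := by
  have hs : (R ^ 2 - ‖x‖ ^ 2) / (r * R) < 0 :=
    div_neg_of_neg_of_pos (by nlinarith [norm_nonneg x]) (mul_pos hr hR)
  have hev : Real.smoothTransition =ᶠ[𝓝 ((R ^ 2 - ‖x‖ ^ 2) / (r * R))] fun _ => (0 : ℝ) := by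
    filter_upwards [Iio_mem_nhds hs] with y hy
    exact Real.smoothTransition.zero_of_nonpos (le_of_lt hy)
  rw [hev.deriv_eq, deriv_const]

/-- Inside the open core `|x|² < R(R − r)` the argument `s` exceeds `1` and `S′(s) = 0` (`S = 1` near `s`). [folklore] -/
theorem deriv_smoothTransition_arg_eq_zero_of_normSq_lt {R r : ℝ} (hr : 0 < r) (hR : 0 < R)
    {x : EuclideanSpace ℝ (Fin 3)} (hx : ‖x‖ ^ 2 < R * (R - r)) :
    deriv Real.smoothTransition ((R ^ 2 - ‖x‖ ^ 2) / (r * R)) = 0 := by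
  have hs : 1 < (R ^ 2 - ‖x‖ ^ 2) / (r * R) := by
    rw [lt_div_iff₀ (mul_pos hr hR)]
    nlinarith
  have hev : Real.smoothTransition =ᶠ[𝓝 ((R ^ 2 - ‖x‖ ^ 2) / (r * R))] fun _ => (1 : ℝ) := by
    filter_upwards [Ioi_mem_nhds hs] with y hy
    exact Real.smoothTransition.one_of_one_le (le_of_lt hy)
  rw [hev.deriv_eq, deriv_const]

/-- The flux density lives on the closed layer `R(R−r) ≤ |x|² ∧ |x| ≤ R`: off it `Dθ_{R,r}(x) = 0` along every vector. [folklore] -/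
theorem fderiv_taoCutoff_apply_eq_zero_of_not_mem_layer {R r : ℝ} (hr : 0 < r) (hR : 0 < R)
    {x : EuclideanSpace ℝ (Fin 3)} (hx : x ∉ {x : EuclideanSpace ℝ (Fin 3) | R * (R - r) ≤ ‖x‖ ^ 2 ∧ ‖x‖ ≤ R})
    (w : EuclideanSpace ℝ (Fin 3)) : fderiv ℝ (taoCutoff R r) x w = 0 := by
  rw [fderiv_taoCutoff_apply]
  simp only [mem_setOf_eq, not_and_or, not_le] at hx
  rcases hx with h | h
  · rw [deriv_smoothTransition_arg_eq_zero_of_normSq_lt hr hR h]; ring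
  · rw [deriv_smoothTransition_arg_eq_zero_of_lt_norm hr hR h]; ring

/-- Pointwise bound of the flux density term: `|Dθ_{R,r}(x)[w]| ≤ (2M/(rR)) |⟪x, w⟫|` when `|S′| ≤ M`. [cite: Tao2011, §8, proof of Lemma 8.1, (58)] -/
theorem abs_fderiv_taoCutoff_apply_le {R r M : ℝ} (hr : 0 < r) (hR : 0 < R)
    (hM : ∀ s, |deriv Real.smoothTransition s| ≤ M) (x w : EuclideanSpace ℝ (Fin 3)) :
    |fderiv ℝ (taoCutoff R r) x w| ≤ 2 * M / (r * R) * |⟪x, w⟫| := by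
  rw [fderiv_taoCutoff_apply, abs_mul, abs_neg, abs_mul, abs_of_pos (by positivity : (0 : ℝ) < 2 / (r * R))]
  have h := hM ((R ^ 2 - ‖x‖ ^ 2) / (r * R))
  have h0 : 0 ≤ |⟪x, w⟫| := abs_nonneg _
  calc 2 / (r * R) * |deriv Real.smoothTransition ((R ^ 2 - ‖x‖ ^ 2) / (r * R))| * |⟪x, w⟫|
      ≤ 2 / (r * R) * M * |⟪x, w⟫| := by gcongr
    _ = 2 * M / (r * R) * |⟪x, w⟫| := by ring

/-- Two nested Tao cutoffs are ordered: `θ_{R₁,r₁} ≤ θ_{R₂,r₂}` pointwise when `R₁ ≤ R₂ − r₂` (`0 < r_i ≤ R_i`). [folklore] -/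
theorem taoCutoff_le_taoCutoff {R₁ r₁ R₂ r₂ : ℝ} (hr₁ : 0 < r₁) (hr₁R : r₁ ≤ R₁) (hr₂ : 0 < r₂) (hr₂R : r₂ ≤ R₂)
    (hnest : R₁ ≤ R₂ - r₂) (x : EuclideanSpace ℝ (Fin 3)) : taoCutoff R₁ r₁ x ≤ taoCutoff R₂ r₂ x := by
  have hR₁ : 0 < R₁ := hr₁.trans_le hr₁R
  have hR₂ : 0 < R₂ := hr₂.trans_le hr₂R
  by_cases hx : R₁ ≤ ‖x‖
  · rw [taoCutoff_eq_zero hR₁.le hr₁.le hx]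
    exact taoCutoff_nonneg _ _ _
  · rw [taoCutoff_eq_one_of_norm_le hR₂ hr₂ hr₂R (by linarith [not_le.1 hx])]
    exact taoCutoff_le_one _ _ _

/-! ### The boundary-free flux identity -/

section Identity

variable {γ : ℝ} {U : EuclideanSpace ℝ (Fin 3) → EuclideanSpace ℝ (Fin 3)} {P : EuclideanSpace ℝ (Fin 3) → ℝ}

/-- **THE FLUX IDENTITY** (Leray's `∫ div(ω τ W) = 0` with `div W = 3γ`).  For a `C²` self-similar Euler profile (centre `0`), `ω ∈ C¹` and
`τ ∈ C¹_c`:  `3γ ∫ ω τ + ∫ ω Dτ[W] + ∫ τ Dω[W] = 0`, `W = γy + U`. [cite: Leray1934, §6 (1.11) p. 203; ConstantinIgnatovaVicol2026Putative §3.4.1 (3.22)] -/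
theorem flux_identity (hprof : IsSelfSimilarEulerProfile γ 0 U P) {ω τ : EuclideanSpace ℝ (Fin 3) → ℝ}
    (hω : ContDiff ℝ 1 ω) (hτ : ContDiff ℝ 1 τ) (hτc : HasCompactSupport τ) :
    3 * γ * (∫ x, ω x * τ x) + (∫ x, ω x * fderiv ℝ τ x (selfSimilarTransport γ 0 U x)) +
      ∫ x, τ x * fderiv ℝ ω x (selfSimilarTransport γ 0 U x) = 0 := by
  set W : EuclideanSpace ℝ (Fin 3) → EuclideanSpace ℝ (Fin 3) := selfSimilarTransport γ 0 U with hWdef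
  have hU1 : ContDiff ℝ 1 U := hprof.contDiff_velocity.of_le (by norm_num)
  have hW1 : ContDiff ℝ 1 W :=
    ((contDiff_id.sub contDiff_const).const_smul γ).add hU1
  have hWc : Continuous W := hW1.continuous
  have hθ : ContDiff ℝ 1 fun x => ω x * τ x := hω.mul hτ
  have hθc : HasCompactSupport fun x => ω x * τ x := hτc.mul_left
  have h := integral_mul_divergence_add_eq_zero_left (u := W) hθ hW1 hθc
  -- `div W = 3γ`
  have hdiv : ∀ x, VectorCalculus.divergence W x = 3 * γ := fun x =>
    divergence_selfSimilarTransport (hU1.differentiable one_ne_zero) hprof.divFree x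
  have h1 : (∫ x, ω x * τ x * VectorCalculus.divergence W x) = 3 * γ * ∫ x, ω x * τ x := by
    rw [← integral_const_mul]
    exact integral_congr_ae (Eventually.of_forall fun x => by
      show ω x * τ x * VectorCalculus.divergence W x = 3 * γ * (ω x * τ x)
      rw [hdiv x]; ring)
  -- the gradient term, by the product rule
  have hωd : ∀ x, DifferentiableAt ℝ ω x := fun x => hω.differentiable one_ne_zero x
  have hτd : ∀ x, DifferentiableAt ℝ τ x := fun x => hτ.differentiable one_ne_zero x
  have h2 : ∀ x, ⟪W x, gradient (fun x => ω x * τ x) x⟫ =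
      ω x * fderiv ℝ τ x (W x) + τ x * fderiv ℝ ω x (W x) := fun x => by
    rw [real_inner_comm, gradient, InnerProductSpace.toDual_symm_apply, fderiv_fun_mul (hωd x) (hτd x)]
    simp only [_root_.add_apply, _root_.FunLike.coe_smul, Pi.smul_apply, smul_eq_mul]
  have hint1 : Integrable fun x => ω x * fderiv ℝ τ x (W x) := by
    refine (hω.continuous.mul ((hτ.continuous_fderiv one_ne_zero).clm_apply hWc)).integrable_of_hasCompactSupport ?_
    refine HasCompactSupport.mul_left ((hτc.fderiv (𝕜 := ℝ)).mono fun x hx h0 => hx ?_)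
    simp [h0]
  have hint2 : Integrable fun x => τ x * fderiv ℝ ω x (W x) :=
    (hτ.continuous.mul ((hω.continuous_fderiv one_ne_zero).clm_apply hWc)).integrable_of_hasCompactSupport hτc.mul_right
  have h3 : (∫ x, ⟪W x, gradient (fun x => ω x * τ x) x⟫) =
      (∫ x, ω x * fderiv ℝ τ x (W x)) + ∫ x, τ x * fderiv ℝ ω x (W x) := by
    rw [← integral_add hint1 hint2]
    exact integral_congr_ae (Eventually.of_forall h2)
  rw [h1, h3] at h
  linarith

end Identity

/-! ### Shell form: two nested Tao cutoffs -/

section Shell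

variable {γ : ℝ} {U : EuclideanSpace ℝ (Fin 3) → EuclideanSpace ℝ (Fin 3)} {P : EuclideanSpace ℝ (Fin 3) → ℝ}

/-- The flux integrand `ω · Dθ_{R,r}[W]` is continuous and vanishes off the closed ball `B̄_R`, hence is integrable
(`ω`, `W` continuous, `0 < r ≤ R`). [folklore] -/
theorem integrable_mul_fderiv_taoCutoff_apply {ω : EuclideanSpace ℝ (Fin 3) → ℝ}
    {W : EuclideanSpace ℝ (Fin 3) → EuclideanSpace ℝ (Fin 3)} (hω : Continuous ω) (hW : Continuous W)
    {R r : ℝ} (hr : 0 < r) (hrR : r ≤ R) :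
    Integrable fun x => ω x * fderiv ℝ (taoCutoff R r) x (W x) := by
  have hR : 0 < R := hr.trans_le hrR
  have hc : Continuous fun x => ω x * fderiv ℝ (taoCutoff R r) x (W x) :=
    hω.mul (((contDiff_taoCutoff (n := 1) R r).continuous_fderiv one_ne_zero).clm_apply hW)
  refine hc.integrable_of_hasCompactSupport ?_
  refine HasCompactSupport.of_support_subset_isCompact (isCompact_closedBall (0 : EuclideanSpace ℝ (Fin 3)) R)
    fun x hx => ?_
  rw [mem_closedBall, dist_zero_right]
  by_contra hxR
  refine hx ?_
  have h0 : fderiv ℝ (taoCutoff R r) x (W x) = 0 :=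
    fderiv_taoCutoff_apply_eq_zero_of_not_mem_layer hr hR (fun h => hxR h.2) (W x)
  simp [h0]

/-- **THE SHELL FLUX IDENTITY.**  For nested Tao cutoffs `θ_in = θ_{R₁,r₁} ≤ θ_out = θ_{R₂,r₂}` (`R₁ ≤ R₂ − r₂`) and `ω ∈ C¹`:
`F_out(ω) − F_in(ω) = 3γ ∫ ω (θ_out − θ_in) + ∫ (θ_out − θ_in) Dω[W]`, where `F_{R,r}(ω) = ∫ ω · (−Dθ_{R,r}[W])` is the smeared outward
radial `W`-flux of the `ω`-set through the layer `R(R−r) ≤ |x|² ≤ R²`. [cite: Leray1934, §6 (1.11) p. 203] -/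
theorem flux_shell_identity (hprof : IsSelfSimilarEulerProfile γ 0 U P) {ω : EuclideanSpace ℝ (Fin 3) → ℝ}
    (hω : ContDiff ℝ 1 ω) {R₁ r₁ R₂ r₂ : ℝ} (hr₁ : 0 < r₁) (hr₁R : r₁ ≤ R₁) (hr₂ : 0 < r₂) (hr₂R : r₂ ≤ R₂)
    (hnest : R₁ ≤ R₂ - r₂) :
    (∫ x, ω x * -(fderiv ℝ (taoCutoff R₂ r₂) x (selfSimilarTransport γ 0 U x))) -
        ∫ x, ω x * -(fderiv ℝ (taoCutoff R₁ r₁) x (selfSimilarTransport γ 0 U x)) =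
      3 * γ * (∫ x, ω x * (taoCutoff R₂ r₂ x - taoCutoff R₁ r₁ x)) +
        ∫ x, (taoCutoff R₂ r₂ x - taoCutoff R₁ r₁ x) * fderiv ℝ ω x (selfSimilarTransport γ 0 U x) := by
  set W : EuclideanSpace ℝ (Fin 3) → EuclideanSpace ℝ (Fin 3) := selfSimilarTransport γ 0 U with hWdef
  have hR₁ : 0 < R₁ := hr₁.trans_le hr₁R
  have hR₂ : 0 < R₂ := hr₂.trans_le hr₂R
  have hU1 : ContDiff ℝ 1 U := hprof.contDiff_velocity.of_le (by norm_num)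
  have hWc : Continuous W := (((contDiff_id.sub contDiff_const).const_smul γ).add hU1).continuous
  set τ : EuclideanSpace ℝ (Fin 3) → ℝ := fun x => taoCutoff R₂ r₂ x - taoCutoff R₁ r₁ x with hτdef
  have hθ₁ : ContDiff ℝ 1 (taoCutoff (E := EuclideanSpace ℝ (Fin 3)) R₁ r₁) := contDiff_taoCutoff R₁ r₁
  have hθ₂ : ContDiff ℝ 1 (taoCutoff (E := EuclideanSpace ℝ (Fin 3)) R₂ r₂) := contDiff_taoCutoff R₂ r₂
  have hτ : ContDiff ℝ 1 τ := hθ₂.sub hθ₁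
  have hτc : HasCompactSupport τ := by
    refine HasCompactSupport.of_support_subset_isCompact (isCompact_closedBall (0 : EuclideanSpace ℝ (Fin 3)) R₂)
      fun x hx => ?_
    rw [mem_closedBall, dist_zero_right]
    by_contra hxR
    refine hx ?_
    have h2 : R₂ ≤ ‖x‖ := (not_le.1 hxR).le
    simp only [hτdef, taoCutoff_eq_zero hR₂.le hr₂.le h2, taoCutoff_eq_zero hR₁.le hr₁.le (by linarith), sub_zero]
  have hid := flux_identity hprof hω hτ hτc
  -- split `∫ ω Dτ[W]`
  have hdτ : ∀ x, fderiv ℝ τ x (W x) = fderiv ℝ (taoCutoff R₂ r₂) x (W x) - fderiv ℝ (taoCutoff R₁ r₁) x (W x) := fun x => by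
    simp only [hτdef]
    rw [fderiv_fun_sub (hθ₂.differentiable one_ne_zero x) (hθ₁.differentiable one_ne_zero x)]
    rfl
  have hi₁ := integrable_mul_fderiv_taoCutoff_apply hω.continuous hWc hr₁ hr₁R
  have hi₂ := integrable_mul_fderiv_taoCutoff_apply hω.continuous hWc hr₂ hr₂R
  have hsplit : (∫ x, ω x * fderiv ℝ τ x (W x)) =
      (∫ x, ω x * fderiv ℝ (taoCutoff R₂ r₂) x (W x)) - ∫ x, ω x * fderiv ℝ (taoCutoff R₁ r₁) x (W x) := by
    rw [← integral_sub hi₂ hi₁]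
    exact integral_congr_ae (Eventually.of_forall fun x => by
      show ω x * fderiv ℝ τ x (W x) = ω x * fderiv ℝ (taoCutoff R₂ r₂) x (W x) - ω x * fderiv ℝ (taoCutoff R₁ r₁) x (W x)
      rw [hdτ x]; ring)
  have hn₁ : (∫ x, ω x * -(fderiv ℝ (taoCutoff R₁ r₁) x (W x))) = -∫ x, ω x * fderiv ℝ (taoCutoff R₁ r₁) x (W x) := by
    rw [← integral_neg]; exact integral_congr_ae (Eventually.of_forall fun x => by simp)
  have hn₂ : (∫ x, ω x * -(fderiv ℝ (taoCutoff R₂ r₂) x (W x))) = -∫ x, ω x * fderiv ℝ (taoCutoff R₂ r₂) x (W x) := by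
    rw [← integral_neg]; exact integral_congr_ae (Eventually.of_forall fun x => by simp)
  rw [hn₁, hn₂]
  rw [hsplit] at hid
  linarith

/-- **THE EXIT LAW.**  If moreover `ω` is non-increasing along `W` (`Dω[W] ≤ 0`), then
`F_out(ω) − F_in(ω) ≤ 3γ ∫ ω (θ_out − θ_in)`: between two nested layers the smeared outward flux of the `ω`-set grows at most by `3γ ×` the
`ω`-mass in between — the flow leaves the `ω`-set through its lateral boundary (`div W = 3γ`, CIV (3.22); for `ω = S((ℋ−h)/η)` this is CIV (3.33)).
[cite: ConstantinIgnatovaVicol2026Putative, §3.4.1 (3.22), §3.4.3 (3.33)] -/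
theorem flux_exit_law (hprof : IsSelfSimilarEulerProfile γ 0 U P) {ω : EuclideanSpace ℝ (Fin 3) → ℝ}
    (hω : ContDiff ℝ 1 ω) (hanti : ∀ x, fderiv ℝ ω x (selfSimilarTransport γ 0 U x) ≤ 0)
    {R₁ r₁ R₂ r₂ : ℝ} (hr₁ : 0 < r₁) (hr₁R : r₁ ≤ R₁) (hr₂ : 0 < r₂) (hr₂R : r₂ ≤ R₂) (hnest : R₁ ≤ R₂ - r₂) :
    (∫ x, ω x * -(fderiv ℝ (taoCutoff R₂ r₂) x (selfSimilarTransport γ 0 U x))) -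
        ∫ x, ω x * -(fderiv ℝ (taoCutoff R₁ r₁) x (selfSimilarTransport γ 0 U x)) ≤
      3 * γ * ∫ x, ω x * (taoCutoff R₂ r₂ x - taoCutoff R₁ r₁ x) := by
  rw [flux_shell_identity hprof hω hr₁ hr₁R hr₂ hr₂R hnest]
  have hle : (∫ x, (taoCutoff R₂ r₂ x - taoCutoff R₁ r₁ x) * fderiv ℝ ω x (selfSimilarTransport γ 0 U x)) ≤ 0 :=
    integral_nonpos fun x => mul_nonpos_of_nonneg_of_nonpos
      (sub_nonneg.2 (taoCutoff_le_taoCutoff hr₁ hr₁R hr₂ hr₂R hnest x)) (hanti x)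
  linarith

/-! ### The size of the outer flux -/

/-- `‖γy + U y‖² ≤ 2γ²‖y‖² + 2‖U y‖²`. [folklore] -/
theorem norm_selfSimilarTransport_sq_le (γ : ℝ) (U : EuclideanSpace ℝ (Fin 3) → EuclideanSpace ℝ (Fin 3))
    (y : EuclideanSpace ℝ (Fin 3)) :
    ‖selfSimilarTransport γ 0 U y‖ ^ 2 ≤ 2 * γ ^ 2 * ‖y‖ ^ 2 + 2 * ‖U y‖ ^ 2 := by
  rw [selfSimilarTransport_apply, sub_zero]
  have h1 : ‖γ • y + U y‖ ≤ ‖γ • y‖ + ‖U y‖ := norm_add_le _ _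
  have h2 : ‖γ • y‖ = |γ| * ‖y‖ := by rw [norm_smul, Real.norm_eq_abs]
  have h3 : |γ| ^ 2 = γ ^ 2 := sq_abs γ
  nlinarith [norm_nonneg (γ • y + U y), norm_nonneg (γ • y), norm_nonneg (U y), abs_nonneg γ,
    sq_nonneg (‖γ • y‖ - ‖U y‖)]

/-- **THE OUTER FLUX IS SMALL ON THIN SETS.**  For `0 ≤ ω ≤ 1` continuous, `0 < r ≤ R`, `|S′| ≤ M`, and
`A = {R(R−r) ≤ |x|² ∧ |x| ≤ R} ∩ {ω ≠ 0}` (the part of the layer charged by `ω`):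
`|F_{R,r}(ω)| ≤ (2M/(rR)) · (R²/2 · vol A + γ²R² · vol A + ∫_{B̄_R} ‖U‖²)`
(pointwise `|ω Dθ[W]| ≤ (2M/(rR))|⟪x, W⟫| ≤ (2M/(rR))(R²/2 + ‖W‖²/2)` on `A`, `0` off `A`, and `‖W‖² ≤ 2γ²R² + 2‖U‖²`). [folklore] -/
theorem abs_flux_le {ω : EuclideanSpace ℝ (Fin 3) → ℝ} (hωc : Continuous ω) (hω0 : ∀ x, 0 ≤ ω x) (hω1 : ∀ x, ω x ≤ 1)
    (hU : Continuous U) {R r M : ℝ} (hr : 0 < r) (hrR : r ≤ R) (hM : ∀ s, |deriv Real.smoothTransition s| ≤ M) :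
    |∫ x, ω x * -(fderiv ℝ (taoCutoff R r) x (selfSimilarTransport γ 0 U x))| ≤
      2 * M / (r * R) * (R ^ 2 / 2 * (volume ({x : EuclideanSpace ℝ (Fin 3) | R * (R - r) ≤ ‖x‖ ^ 2 ∧ ‖x‖ ≤ R} ∩ {x | ω x ≠ 0})).toReal +
        γ ^ 2 * R ^ 2 * (volume ({x : EuclideanSpace ℝ (Fin 3) | R * (R - r) ≤ ‖x‖ ^ 2 ∧ ‖x‖ ≤ R} ∩ {x | ω x ≠ 0})).toReal +
          ∫ x in closedBall (0 : EuclideanSpace ℝ (Fin 3)) R, ‖U x‖ ^ 2) := by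
  set W : EuclideanSpace ℝ (Fin 3) → EuclideanSpace ℝ (Fin 3) := selfSimilarTransport γ 0 U with hWdef
  set A : Set (EuclideanSpace ℝ (Fin 3)) := {x | R * (R - r) ≤ ‖x‖ ^ 2 ∧ ‖x‖ ≤ R} ∩ {x | ω x ≠ 0} with hAdef
  have hR : 0 < R := hr.trans_le hrR
  have hM0 : 0 ≤ M := (abs_nonneg _).trans (hM 0)
  have hK : 0 ≤ 2 * M / (r * R) := by positivity
  have hWc : Continuous W := (((continuous_id.sub continuous_const).const_smul γ).add hU :)
  -- measurability / finiteness of `A`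
  have hAm : MeasurableSet A := by
    refine (IsClosed.measurableSet ?_).inter ?_
    · exact (isClosed_le continuous_const (continuous_norm.pow 2)).inter (isClosed_le continuous_norm continuous_const)
    · exact (isOpen_ne_fun hωc continuous_const).measurableSet
  have hAsub : A ⊆ closedBall (0 : EuclideanSpace ℝ (Fin 3)) R := fun x hx => by
    rw [mem_closedBall, dist_zero_right]; exact hx.1.2
  have hAfin : volume A < ∞ := (measure_mono hAsub).trans_lt measure_closedBall_lt_top
  -- the dominating function
  set g : EuclideanSpace ℝ (Fin 3) → ℝ := A.indicator fun x => 2 * M / (r * R) * (R ^ 2 / 2 + ‖W x‖ ^ 2 / 2) with hgdef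
  have hgi_on : IntegrableOn (fun x => 2 * M / (r * R) * (R ^ 2 / 2 + ‖W x‖ ^ 2 / 2)) A := by
    refine ((continuous_const.mul (continuous_const.add ((hWc.norm.pow 2).div_const 2))).continuousOn.integrableOn_compact
      (isCompact_closedBall (0 : EuclideanSpace ℝ (Fin 3)) R)).mono_set hAsub
  have hgi : Integrable g := hgi_on.integrable_indicator hAm
  have hpt : ∀ x, ‖ω x * -(fderiv ℝ (taoCutoff R r) x (W x))‖ ≤ g x := by
    intro x
    rw [Real.norm_eq_abs]
    by_cases hx : x ∈ A
    · rw [hgdef, indicator_of_mem hx]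
      have h1 : |ω x * -(fderiv ℝ (taoCutoff R r) x (W x))| ≤ |fderiv ℝ (taoCutoff R r) x (W x)| := by
        rw [abs_mul, abs_neg, abs_of_nonneg (hω0 x)]
        exact mul_le_of_le_one_left (abs_nonneg _) (hω1 x)
      have h2 := abs_fderiv_taoCutoff_apply_le hr hR hM x (W x)
      have h3 : |⟪x, W x⟫| ≤ R * ‖W x‖ :=
        (abs_real_inner_le_norm _ _).trans (mul_le_mul_of_nonneg_right hx.1.2 (norm_nonneg _))
      have h4 : R * ‖W x‖ ≤ R ^ 2 / 2 + ‖W x‖ ^ 2 / 2 := by nlinarith [sq_nonneg (R - ‖W x‖)]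
      calc |ω x * -(fderiv ℝ (taoCutoff R r) x (W x))| ≤ |fderiv ℝ (taoCutoff R r) x (W x)| := h1
        _ ≤ 2 * M / (r * R) * |⟪x, W x⟫| := h2
        _ ≤ 2 * M / (r * R) * (R ^ 2 / 2 + ‖W x‖ ^ 2 / 2) := mul_le_mul_of_nonneg_left (h3.trans h4) hK
    · rw [hgdef, indicator_of_notMem hx]
      have hzero : ω x * -(fderiv ℝ (taoCutoff R r) x (W x)) = 0 := by
        simp only [hAdef, mem_inter_iff, mem_setOf_eq, not_and_or] at hx
        rcases hx with hx | hx
        · rw [fderiv_taoCutoff_apply_eq_zero_of_not_mem_layer hr hR (by simpa only [mem_setOf_eq, not_and_or] using hx),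
            neg_zero, mul_zero]
        · rw [not_not.1 hx, zero_mul]
      rw [hzero, abs_zero]
  have hmain := norm_integral_le_of_norm_le hgi (Eventually.of_forall hpt)
  rw [Real.norm_eq_abs] at hmain
  -- evaluate `∫ g`
  have hWi : IntegrableOn (fun x => ‖W x‖ ^ 2) A :=
    ((hWc.norm.pow 2).continuousOn.integrableOn_compact (isCompact_closedBall (0 : EuclideanSpace ℝ (Fin 3)) R)).mono_set hAsub
  have hg_eval : (∫ x, g x) = 2 * M / (r * R) * (R ^ 2 / 2 * (volume A).toReal + 1 / 2 * ∫ x in A, ‖W x‖ ^ 2) := by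
    rw [hgdef, integral_indicator hAm, integral_const_mul, integral_add ((integrableOn_const_iff (C := (R ^ 2 / 2 : ℝ))).2 (Or.inr hAfin)) (hWi.div_const 2),
      setIntegral_const, smul_eq_mul, measureReal_def]
    congr 1
    rw [show (fun x => ‖W x‖ ^ 2 / 2) = fun x => 1 / 2 * ‖W x‖ ^ 2 by funext x; ring, integral_const_mul]
    ring
  -- bound `∫_A ‖W‖²`
  have hUi : IntegrableOn (fun x => ‖U x‖ ^ 2) (closedBall (0 : EuclideanSpace ℝ (Fin 3)) R) :=
    (hU.norm.pow 2).continuousOn.integrableOn_compact (isCompact_closedBall (0 : EuclideanSpace ℝ (Fin 3)) R)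
  have hWA : (∫ x in A, ‖W x‖ ^ 2) ≤ 2 * γ ^ 2 * R ^ 2 * (volume A).toReal + 2 * ∫ x in closedBall (0 : EuclideanSpace ℝ (Fin 3)) R, ‖U x‖ ^ 2 := by
    have h1 : (∫ x in A, ‖W x‖ ^ 2) ≤ ∫ x in A, (2 * γ ^ 2 * R ^ 2 + 2 * ‖U x‖ ^ 2) := by
      refine setIntegral_mono_on hWi (((integrableOn_const_iff (C := (2 * γ ^ 2 * R ^ 2 : ℝ))).2 (Or.inr hAfin)).add ((hUi.mono_set hAsub).const_mul 2)) hAm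
        fun x hx => ?_
      have hxR : ‖x‖ ^ 2 ≤ R ^ 2 := pow_le_pow_left₀ (norm_nonneg _) hx.1.2 2
      calc ‖W x‖ ^ 2 ≤ 2 * γ ^ 2 * ‖x‖ ^ 2 + 2 * ‖U x‖ ^ 2 := norm_selfSimilarTransport_sq_le γ U x
        _ ≤ 2 * γ ^ 2 * R ^ 2 + 2 * ‖U x‖ ^ 2 := by nlinarith [sq_nonneg γ]
    have h2 : (∫ x in A, (2 * γ ^ 2 * R ^ 2 + 2 * ‖U x‖ ^ 2)) =
        2 * γ ^ 2 * R ^ 2 * (volume A).toReal + 2 * ∫ x in A, ‖U x‖ ^ 2 := by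
      rw [integral_add ((integrableOn_const_iff (C := (2 * γ ^ 2 * R ^ 2 : ℝ))).2 (Or.inr hAfin)) ((hUi.mono_set hAsub).const_mul 2), setIntegral_const,
        integral_const_mul, smul_eq_mul, measureReal_def]
      ring
    have h3 : (∫ x in A, ‖U x‖ ^ 2) ≤ ∫ x in closedBall (0 : EuclideanSpace ℝ (Fin 3)) R, ‖U x‖ ^ 2 :=
      setIntegral_mono_set hUi (ae_of_all _ fun x => sq_nonneg _) hAsub.eventuallyLE
    linarith
  have hv0 : 0 ≤ (volume A).toReal := ENNReal.toReal_nonneg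
  calc |∫ x, ω x * -(fderiv ℝ (taoCutoff R r) x (W x))| ≤ ∫ x, g x := hmain
    _ = 2 * M / (r * R) * (R ^ 2 / 2 * (volume A).toReal + 1 / 2 * ∫ x in A, ‖W x‖ ^ 2) := hg_eval
    _ ≤ 2 * M / (r * R) * (R ^ 2 / 2 * (volume A).toReal + γ ^ 2 * R ^ 2 * (volume A).toReal +
          ∫ x in closedBall (0 : EuclideanSpace ℝ (Fin 3)) R, ‖U x‖ ^ 2) := by
        refine mul_le_mul_of_nonneg_left ?_ hK
        linarith

end Shell

end Summit.NavierStokesRegularity.NavierStokesRegularity.Theorems.PowerGaugeEulerLiouville.HighSetFlux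

end
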